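import Summits.HodgeConjecture.HodgeConjecture.Theorems.Ring2AtlasSixfolds
import Mathlib.NumberTheory.Cyclotomic.Basic
import HarnessLib

/-!
# Ring 2 · atlas-2 (generation 3) — typed record of the K3-QUOTIENT cell theorem (row `g6.S_ExY4_E.cyclic`, `E = ℚ(ζ₅)`)

HONEST FRAMING: research route conditional on HC_CM; not a corollary; Q11.4-sentence-2 already refuted in dim ≥ 3.

Cell `pub-hodge-ring2`, seat `pub-hodge-ring2-atlas-2`, generation 3. Companion of `Ring2AtlasSixfolds` §2 (the NEW
ROW `HodgeQuarticTypeIVFourfoldTimesCMSurface` and the typed claim `QuarticTypeIVFourfoldCMSurfaceSpanFailure`).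
Nothing in this file asserts an open statement: the two `def`s below are `Prop`s recording, over the tree's
vocabulary, WHAT the cell's generation-3 write-up `run/shared/lean/pub/pub-hodge-ring2/pub-hodge-ring2-atlas-2-g3/K3-QUOTIENT.md`
claims to prove by hand (refereeing pending; NOT a cited fact, NOT a hypothesis of anything on the summit path);
the theorems are the formal edges placing that claim between the typed claim of generation 1 and the open cell.

THE CLAIM (informal; `K3-QUOTIENT.md` Thm A, B, Cor C). Let `E = ℚ(ζ₅)`, `B₀ = Jac(y² = x⁵ + 1)` (the simple CM
abelian surface with CM by `E`), and for `λ ∈ ℂ ∖ {0,1}` let `C_λ : y⁵ = x(x-1)(x-λ)` (genus 4) and `Y_λ = J(C_λ)`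
(the de Jong–Noot family; van Geemen–Schütt 2010 §8: signature `(2,0),(1,1)`, image in `A₄` a compact Shimura curve).
(A) The quotient surface `(C_λ × C_λ)/D₅`, `D₅ = ⟨(φ, φ⁻¹), swap⟩`, is the normalised `μ₅`-cover of `ℙ²` branched
along FOUR LINES IN GENERAL POSITION with exponents `(1,1,1,2)`; hence it does not depend on `λ`; it has
`3 A₄ + 3 × 1/5(1,2)` singular points, `e = 7`, `χ(𝒪) = 2`, `q = 0`, `p_g = 1`, and its minimal resolution is a K3
surface `S` blown up once (`ρ(S) = 18`); for EVERY `λ` the quotient correspondence identifies `T(S)_ℚ` with the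
`E`-determinant `∧²_E H¹(Y_λ, ℚ) ⊂ H²(Y_λ, ℚ)` (rank 4, K3 type). (B) Transporting algebraic classes through `S` from a
smooth split-CM fibre (`Y_{λ₀} ~ B₀²`, where `B•(B₀³)` is divisorial by Tankeev–Ribet) along algebraic
correspondences (Lieberman: `Λ` algebraic on abelian varieties): for every `λ` the four "K3-partner" Hodge classes
`Hom_HS((∧²_E H¹(Y_λ))^∨(-2), T(B₀)) ⊂ B²(Y_λ × B₀)` are ALGEBRAIC. (C) For `λ` non-CM, `End⁰(Y_λ) = E`, `Y_λ` is
simple of type IV(2,1), `B•(Y_λ × B₀) = D• + D•·K` (cell engine C, a fourth independent computation of the row: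
`b = (1,4,12,14,12,4,1)`, `d = (1,4,8,10,8,4,1)`), hence the Hodge conjecture holds for `Y_λ × B₀`. Inputs: Tankeev 1982
/ Ribet 1983, Lefschetz (1,1), Lieberman 1968, Deligne–Mostow 1986 (INT for `(2,2,2,4)/5`) / van Geemen–Schütt 2010
§§3, 8. NOT used: `HC_CM` (`Theses.RankFourFaces.CMAbelianHodge`), `HC_AV` (`Theses.PadicSemiregularLift.HodgeAbelianVarieties`),
any variational Hodge conjecture, Kuga–Satake. SCOPE: one hermitian discriminant class for `(ℚ(ζ₅); (2,0),(1,1))`;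
every other class, every other quartic CM field and the simple-CM fibres remain OPEN, so the cell
`HodgeQuarticTypeIVFourfoldTimesCMSurface` stays OPEN.

GENERATION 3, §9 / GENERATION 4 (hand write-ups `K3-QUOTIENT.md` §9 and `pub-hodge-ring2-atlas-2-g4/K3Q-DELTA.md`;
nothing below is asserted in Lean). §9 runs (A)–(C) for ALL four-branch-point cyclic families `y^d = ∏ (x - x_i)^{a_i}`
whose new part has quartic `E = ℚ(ζ_d)` and signature `(2,0),(1,1)`: 17 families, `d ∈ {5, 8, 10, 12}` (two
independent enumerations), each with its own K3 quotient surface and CM partner. Generation 4 computes, for each, the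
discriminant `δ = det H ∈ E₀^× / N_{E/E₀}(E^×)` of the `E`-hermitian form on the order-`d` piece of `H¹` (normalised:
definite place = the place `√m > 0` of `E₀ = ℚ(√m)`), an isogeny invariant of the non-CM fibres that, with the
signatures, classifies `(H¹, H, ι)` (Landherr) and hence the Shimura curve. Two independent engines (A: cellular
cochains of the lifted bipyramid triangulation, Alexander–Whitney cup product, `ζ`-eigenspace Gram determinant; B:
Kita–Yoshida's intersection numbers of loaded intervals, `δ = h₁h₂`, `h_i = (ζ-ζ⁻¹)(c(a_s)+c(a_t))/2`,
`c(a) = (1+ζ^a)/(1-ζ^a)`, one value per boundary pairing) agree modulo norms on 17/17 families, and two norm tests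
(Hasse local symbols; PARI `rnfisnorm`, kit job j072320) sort them into exactly FIVE classes:
`ℚ(ζ₅) ⊃ ℚ(√5)`: `δ ≡ 2+√5` — `(5;1,1,1,2)` (de Jong–Noot), `(10;1,1,2,6)`, `(10;1,2,3,4)`; quaternion algebra
`(b,-δ)` ramified at `{∞₊, 𝔭₅}` — and `δ ≡ 2(2+√5)` — `(10;1,1,3,5)`, `(10;1,2,2,5)`; ramified at `{∞₊, 𝔭₂}` (a
SECOND `ℚ(ζ₅)`-curve: `2` is inert in `ℚ(√5)` and in `ℚ(ζ₅)/ℚ(√5)`, so the ratio `2` is not a norm);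
`ℚ(ζ₈) ⊃ ℚ(√2)`: `δ ≡ √2` — all three families; `{∞₊, (√2)}`; `ℚ(ζ₁₂) ⊃ ℚ(√3)`: `δ ≡ 1+√3` — `(12;1,1,1,9)`,
`(1,1,3,7)`, `(1,2,3,6)`, `(1,3,4,4)`, `(1,3,10,10)`; `{∞₊, 𝔭₂}` — and `δ ≡ √3` — `(12;1,1,2,8)`, `(1,1,4,6)`,
`(1,2,4,5)`, `(2,3,3,4)`; `{∞₊, 𝔭₃}`. So, granted the hand proof, the Hodge conjecture holds for `P × Z` (`P` any
non-CM point, `Z` the partner) on exactly five compact unitary Shimura curves; each boundary pairing `{s,t}|{u,v}`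
(`a_s + a_t ≢ 0`) is a split CM point `A_{st} × A_{uv}` of the curve with `H = ⟨h₁⟩ ⊥ ⟨h₂⟩` — for `ℚ(ζ₅)` both
factors are isogenous to `B₀` —, which is the anchor fibre of Step 0 of (B) made explicit. THIRD CERTIFICATION
AND LABELS (engine T, `K3Q-DELTA.md` §6): the monodromy on the indefinite eigenspace is the Deligne–Mostow group
`Γ_μ`, for four points a triangle group (INT) or of index ≤ 6 in one (ΣINT) [DeligneMostow1986], commensurable with
the arithmetic group of `(E₀, (b,-δ))`; reading each family's triangle group off the Schwarz exponents
`|1 - μ_s - μ_t|` and its commensurability class (field, ramified primes) off Takeuchi's table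
[Takeuchi1977Commensurability; MaclachlanReid2003, App. 13.3 and Thm. 8.4.6] reproduces the five classes with
their fields and ramification on 17/17 families without any intersection-form computation: the classes are
Takeuchi's nos. 8 (`ℚ(√5)`, `𝔭₅`: de Jong–Noot's family lives on `𝔇/T(5,5,5)`, `(10;1,2,3,4)` on `𝔇/T(2,5,10)`),
6 (`ℚ(√5)`, `𝔭₂`: `T(2,5,5)`, `T(5,10,10)`), 3 (`ℚ(√2)`, `𝔭₂`: `T(4,4,4)`, `T(4,8,8)`, `T(2,8,8)`),
4 (`ℚ(√3)`, `𝔭₂`: `T(6,6,6)`, `T(3,3,6)`, `T(3,4,12)`, `T(3,12,12)`, `T(2,3,12)`) and 5 (`ℚ(√3)`, `𝔭₃`: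
`T(4,4,6)`, `T(6,12,12)`, `T(2,4,12)`, `T(2,12,12)`). Finer than commensurability (inclusions certified by
permutation representations, `K3Q-DELTA.md` §6 (v)): the families of classes 8, 3, 4, 5 factor through ONE maximal
triangle curve each — `𝔇/T(2,3,10)` (`T(5,5,5) <₂ T(2,5,10) <₃ T(2,3,10)`), `𝔇/T(2,4,8)`, `𝔇/T(2,3,12)`,
`𝔇/T(2,4,12)` —, while the two families of class 6 reach the distinct maximal curves `𝔇/T(2,4,5)` and `𝔇/T(2,4,10)`
and meet only up to commensurability. REFEREE STATUS (cell-internal): A(2) and A(3) confirmed by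
independent recounts (ref2 §36.6, §37.7); A(1), B and the generation-4 classes: pending (the classes now carry three
mutually independent derivations A = B = T). Nearest print (searched, cell FRESHNESS `## atlas-2 (gen 3)`):
Paranjape, Compositio Math. 68 (1988) (six-line K3 double planes `≃ (C × C)/G`, the model of the construction);
Schoen 1988 (the `ℚ(ζ₃)` cousin of the anchor-and-transport step); van Geemen–Schütt 2010 (the family).
-/

open CategoryTheory

namespace Summit.HodgeConjecture.HodgeConjecture.Ring2.Atlas

open Literature.AlgebraicGeometry Literature.AlgebraicGeometry.Motives
open Literature.AlgebraicGeometry.HodgeTheory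
open Literature.AlgebraicGeometry.Milne1999
open Summit.HodgeConjecture.HodgeConjecture.Theses
open Summit.HodgeConjecture.HodgeConjecture.Ring2.ClassTargets
open Summit.HodgeConjecture.HodgeConjecture.Ring2.Motiv

/-! ## §1 The typed record -/

/-- **K3-PARTNER CLASSES, ALGEBRAIC INSTANCE (generic quartic field).** There exist a simple abelian fourfold `Y` of
type IV with quartic-field endomorphism algebra and a CM abelian surface `Z` such that the Hodge classes of `Y × Z`
are NOT spanned by exterior products of Hodge classes of the factors (generation 1's
`QuarticTypeIVFourfoldCMSurfaceSpanFailure`) AND YET the Hodge conjecture holds for `Y × Z`. CLAIMED by the cell's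
generation-3 write-up `K3-QUOTIENT.md` (Cor. C with `E = ℚ(ζ₅)`, `Y = J(y⁵ = x(x-1)(x-λ))` for `λ` non-CM, `Z = Jac(y² = x⁵+1)`;
refereeing pending) — recorded here as a `Prop`, nothing asserted; it follows from the open cell
(`k3PartnerAlgebraicInstance_of_spanFailure_of_cell`) and refines the typed claim
(`spanFailure_of_k3PartnerAlgebraicInstance`). [cite: GeemenSchuett2010, §8] [cite: MoonenZarhin1999LowDim, §5 Case 2]
[cite: Schoen1988HodgeWeil, §3] [status: open] -/
@[conjecture] def QuarticTypeIVK3PartnerAlgebraicInstance : Prop :=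
  ∃ Y Z : AbelianVariety ℂ, IsQuarticFieldTypeIVFourfold Y ∧ IsOfCMType Z ∧ Z.dim = 2 ∧
    ¬ HodgeClassesProductSpan Y Z ∧ HodgeConjectureFor (Y.prod Z).dim (Y.prod Z).X

/-- **K3-PARTNER CLASSES, ALGEBRAIC INSTANCE for `E = ℚ(ζ₅)`.** The same with both endomorphism algebras isomorphic
to the fifth cyclotomic field — the precise shape of `K3-QUOTIENT.md` Cor. C (`End⁰(Y_λ) ≅ ℚ(ζ₅) ≅ End⁰(B₀)`).
A `Prop`, nothing asserted; CLAIMED by the cell (refereeing pending). [cite: GeemenSchuett2010, §8]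
[cite: DeligneMostow1986, §14] [cite: Lieberman1968, Thm. 1] [cite: Ribet1983, Thms. 0–3] [status: open] -/
@[conjecture] def CyclotomicFiveK3PartnerAlgebraicInstance : Prop :=
  ∃ Y Z : AbelianVariety ℂ, IsQuarticFieldTypeIVFourfold Y ∧ Nonempty (Y.endAlgebra ≃ₐ[ℚ] CyclotomicField 5 ℚ) ∧
    IsOfCMType Z ∧ Z.dim = 2 ∧ Nonempty (Z.endAlgebra ≃ₐ[ℚ] CyclotomicField 5 ℚ) ∧
    ¬ HodgeClassesProductSpan Y Z ∧ HodgeConjectureFor (Y.prod Z).dim (Y.prod Z).X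

/-! ## §2 Edges (proved) -/

/-- The cyclotomic instance is an instance. [folklore] -/
theorem quarticTypeIVK3PartnerAlgebraicInstance_of_cyclotomicFive
    (h : CyclotomicFiveK3PartnerAlgebraicInstance) : QuarticTypeIVK3PartnerAlgebraicInstance := by
  obtain ⟨Y, Z, hY, -, hZ, h2, -, hS, hH⟩ := h
  exact ⟨Y, Z, hY, hZ, h2, hS, hH⟩

/-- The algebraic instance refines generation 1's typed claim: forgetting algebraicity gives the span failure.
[cite: Lombardo2016, Remark 4.6] -/
theorem spanFailure_of_k3PartnerAlgebraicInstance (h : QuarticTypeIVK3PartnerAlgebraicInstance) :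
    QuarticTypeIVFourfoldCMSurfaceSpanFailure := by
  obtain ⟨Y, Z, hY, hZ, h2, hS, -⟩ := h
  exact ⟨Y, Z, hY, hZ, h2, hS⟩

/-- Conversely, GIVEN the span failure, the algebraic instance is a consequence of the open cell
`HodgeQuarticTypeIVFourfoldTimesCMSurface` (the witness pair lies in the cell by `prodCMCell_prod`). So the record of
§1 sits between the typed claim and the cell. [cite: MoonenZarhin1999LowDim, §3 (3.1)] -/
theorem k3PartnerAlgebraicInstance_of_spanFailure_of_cell (hF : QuarticTypeIVFourfoldCMSurfaceSpanFailure)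
    (hC : HodgeQuarticTypeIVFourfoldTimesCMSurface) : QuarticTypeIVK3PartnerAlgebraicInstance := by
  obtain ⟨Y, Z, hY, hZ, h2, hS⟩ := hF
  exact ⟨Y, Z, hY, hZ, h2, hS, hC _ (prodCMCell_prod (𝒞 := fun W ↦ W.dim = 2) hY hZ h2)⟩

/-- ON-PATH: the summit statement and the span failure give the record (through the cell's on-path lemma
`hodgeQuarticTypeIVFourfoldTimesCMSurface_of_hodgeConjecture`). [cite: Deligne2000, §1] -/
theorem k3PartnerAlgebraicInstance_of_spanFailure_of_hodgeConjecture
    (hF : QuarticTypeIVFourfoldCMSurfaceSpanFailure) (h : _root_.HodgeConjecture) :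
    QuarticTypeIVK3PartnerAlgebraicInstance :=
  k3PartnerAlgebraicInstance_of_spanFailure_of_cell hF (hodgeQuarticTypeIVFourfoldTimesCMSurface_of_hodgeConjecture h)

/-- ON-PATH: `HC_AV` (= `Theses.PadicSemiregularLift.HodgeAbelianVarieties`, by name) and the span failure give the
record. [cite: Deligne2000, §1] -/
theorem k3PartnerAlgebraicInstance_of_spanFailure_of_hodgeAbelianVarieties
    (hF : QuarticTypeIVFourfoldCMSurfaceSpanFailure) (h : PadicSemiregularLift.HodgeAbelianVarieties) :
    QuarticTypeIVK3PartnerAlgebraicInstance :=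
  k3PartnerAlgebraicInstance_of_spanFailure_of_cell hF (hodgeQuarticTypeIVFourfoldTimesCMSurface_of_hodgeAbelianVarieties h)

end Summit.HodgeConjecture.HodgeConjecture.Ring2.Atlas
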